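/-
Copyright (c) 2026 the pub-hodgecm-mathlib formalisation cell (harness21).  Prover seat hodgecm-mathlib-A-p19 (g26): «S3-ram» seeding wave, row (e2)(b) «[T2-c]-ram», layer 3 (ii-b₀):
the anti-fixed part of the ramified coordinate model is `θ` times the fixed part (road «S3-tree», crux H413).
-/
import Literature.NumberTheory.Automorphic.QuadraticRamifiedOrderUnitIndex   -- ★ p846518 (this seat): `coord_unique`, `coord_mul` (the coordinate model `O = j𝒪 ⊕ j𝒪θ`)
import Literature.RingTheory.GaloisAlgebras.InvolutionDescentAntiFixed        -- ★ p846932 (this seat): the defect identity consumes `[Λ⁻ : πΛ^⋆]`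
import HarnessLib

/-!
# The conjugation of the ramified coordinate model `O = j𝒪 ⊕ j𝒪θ` (`θ ↦ −θ`): fixed part `j𝒪`, anti-fixed part `j𝒪·θ = θ·(fixed part)` — zero defect

Topic `NumberTheory/Automorphic`; namespace `Literature.NumberTheory.Automorphic`.  THEOREMS ONLY (no definition, no instance, no notation, no named fact, no `sorry`).
For a ring involution `s` of the coordinate model `O = j𝒪 ⊕ j𝒪θ` (★ p846518 currency: `j : 𝒪[F] →+* O`, unique coordinates) with `s ∘ j = j` and `sθ = −θ` — the conjugation
`σ_w` of `𝒪_w = 𝒪_v ⊕ 𝒪_v Π` at a tame-ramified place (`σ_w Π = −Π`) — the `⋆`-fixed additive subgroup is `j𝒪`, the anti-fixed one (`s x + x = 0`, `2` a non-zero-divisor) is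
`j𝒪·θ`, and **`θ·O^⋆ = O⁻`**: the defect index `[O⁻ : θO^⋆]` of ★ p846932 `index_mul_relIndex_map_eq_sq_mul` is `1` for this factor (A-p19 CERT «[T2-c]-ram» 22:01Z, type A).
* `map_eq_self_iff_of_coord` — `s(jb + jcθ) = jb + jcθ ↔ c·2 = 0`-free form: `s x = x ↔ ∃ b, x = j b` (given `2` regular in `𝒪`);
* `map_add_self_eq_zero_iff_of_coord` — `s x + x = 0 ↔ ∃ c, x = j c * θ`;
* **`map_mulLeft_eqLocus_eq_ker_of_coord`** — `(O^⋆).map (θ·) = O⁻` as additive subgroups, hence `relIndex = 1` (`relIndex_map_mulLeft_eqLocus_ker_eq_one_of_coord`).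
HONEST LABEL: HC_CM is proved only modulo the 2 remaining named inputs (hLiu418 24832, h413 24833) until rung 0 closes; unconditional algebra, count-neutral.

## References
* [SerreLocalFields1979] J.-P. Serre, *Local Fields*, GTM 67 (1979): Ch. I §6 Prop. 17–18 (ramified quadratic integral bases), Ch. V §3.
* [Hungerford1974] T. W. Hungerford, *Algebra*, GTM 73 (1974): Ch. I Thm. 4.5.
-/

set_option autoImplicit false

noncomputable section

open scoped ValuativeRel

namespace Literature.NumberTheory.Automorphic

variable {F : Type*} [Field F] [ValuativeRel F] {O : Type*} [CommRing O] (j : 𝒪[F] →+* O) (θ : O)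
  (hcoord : ∀ z : O, ∃! bc : 𝒪[F] × 𝒪[F], z = j bc.1 + j bc.2 * θ)
  (s : O →+* O) (hsj : ∀ b, s (j b) = j b) (hsθ : s θ = -θ) (h2 : ∀ b : 𝒪[F], b * 2 = 0 → b = 0)

include hcoord hsj hsθ h2 in
/-- **`s x = x ↔ x ∈ j𝒪`** (`s(jb + jcθ) = jb − jcθ`, and `2c = 0 ⇒ c = 0`). [cite: SerreLocalFields1979, Ch. I §6 Prop. 18] -/
theorem map_eq_self_iff_of_coord (x : O) : s x = x ↔ ∃ b : 𝒪[F], x = j b := by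
  obtain ⟨⟨b, c⟩, rfl, -⟩ := hcoord x
  have hs : s (j b + j c * θ) = j b + j (-c) * θ := by rw [map_add, map_mul, hsj, hsj, hsθ, map_neg]; ring
  constructor
  · intro h
    rw [hs] at h
    have hc := (coord_unique j θ hcoord h).2
    have hc0 : c = 0 := h2 c (by linear_combination -hc)
    exact ⟨b, by rw [hc0, map_zero, zero_mul, add_zero]⟩
  · rintro ⟨b', hb'⟩
    have h' : j b + j c * θ = j b' + j 0 * θ := by rw [hb', map_zero, zero_mul, add_zero]
    obtain ⟨-, hc⟩ := coord_unique j θ hcoord h'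
    rw [hs, hc, neg_zero]

include hcoord hsj hsθ h2 in
/-- **`s x + x = 0 ↔ x ∈ j𝒪·θ`**. [cite: SerreLocalFields1979, Ch. I §6 Prop. 18] -/
theorem map_add_self_eq_zero_iff_of_coord (x : O) : s x + x = 0 ↔ ∃ c : 𝒪[F], x = j c * θ := by
  obtain ⟨⟨b, c⟩, rfl, -⟩ := hcoord x
  have hs : s (j b + j c * θ) = j b + j (-c) * θ := by rw [map_add, map_mul, hsj, hsj, hsθ, map_neg]; ring
  constructor
  · intro h
    rw [hs] at h
    have h' : j (b + b) + j 0 * θ = j 0 + j 0 * θ := by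
      rw [map_add, map_zero, zero_mul, add_zero, add_zero]
      have : j b + j (-c) * θ + (j b + j c * θ) = j b + j b := by rw [map_neg]; ring
      rw [← this, h]
    have hb := (coord_unique j θ hcoord h').1
    have hb0 : b = 0 := h2 b (by rw [mul_two]; exact hb)
    exact ⟨c, by rw [hb0, map_zero, zero_add]⟩
  · rintro ⟨c', hc'⟩
    have h' : j b + j c * θ = j 0 + j c' * θ := by rw [hc', map_zero, zero_add]
    obtain ⟨hb, hc⟩ := coord_unique j θ hcoord h'
    rw [hs, hb, hc, map_zero, map_neg]; ring

include hcoord hsj hsθ h2 in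
/-- **`θ·O^⋆ = O⁻`**: the image of the `⋆`-fixed subgroup `eqLocus s id = j𝒪` under `x ↦ θx` is the anti-fixed subgroup `ker (s + id) = j𝒪·θ`.
[cite: SerreLocalFields1979, Ch. I §6 Prop. 18] [cite: Hungerford1974, Ch. I Thm. 4.5] -/
theorem map_mulLeft_eqLocus_eq_ker_of_coord :
    ((RingHom.eqLocus s (RingHom.id O)).toAddSubgroup).map (AddMonoidHom.mulLeft θ) = (s.toAddMonoidHom + AddMonoidHom.id O).ker := by
  ext x
  rw [AddMonoidHom.mem_ker]
  change x ∈ ((RingHom.eqLocus s (RingHom.id O)).toAddSubgroup).map (AddMonoidHom.mulLeft θ) ↔ s x + x = 0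
  rw [map_add_self_eq_zero_iff_of_coord j θ hcoord s hsj hsθ h2]
  constructor
  · rintro ⟨y, hy, rfl⟩
    have hy' : s y = y := hy
    obtain ⟨b, rfl⟩ := (map_eq_self_iff_of_coord j θ hcoord s hsj hsθ h2 y).1 hy'
    exact ⟨b, by change θ * j b = j b * θ; rw [mul_comm]⟩
  · rintro ⟨c, rfl⟩
    refine ⟨j c, ?_, by change θ * j c = j c * θ; rw [mul_comm]⟩
    change s (j c) = j c
    exact hsj c

include hcoord hsj hsθ h2 in
/-- … hence the defect index `[O⁻ : θ·O^⋆] = 1`. [cite: Hungerford1974, Ch. I Thm. 4.5] -/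
theorem relIndex_map_mulLeft_eqLocus_ker_eq_one_of_coord :
    (((RingHom.eqLocus s (RingHom.id O)).toAddSubgroup).map (AddMonoidHom.mulLeft θ)).relIndex (s.toAddMonoidHom + AddMonoidHom.id O).ker = 1 := by
  rw [map_mulLeft_eqLocus_eq_ker_of_coord j θ hcoord s hsj hsθ h2, AddSubgroup.relIndex_self]

end Literature.NumberTheory.Automorphic

end
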